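import Summits.ResolutionOfSingularities.ResolutionOfSingularities.Theorems.PurelyInseparableDim4ChartAtlasGlue
import Literature.AlgebraicGeometry.Resolution.BlowupRestrictOpen
import Literature.AlgebraicGeometry.Resolution.BlowupSNC
import HarnessLib

/-!
# Purely inseparable four-folds `z^p + F(x₁, …, x₄)`: ADMISSIBILITY OF A STRICT TRANSFORM IS LOCAL OVER THE BASE — transport from a
# MODEL open immersion (cell `res-dim4-pi`, typ-2 g7; HANDOFF OPEN 4 «transport of the far repair to the walk's stage objects», generic half)

[OURS · counted 0] (D-0157 DOOR 2; DR-157-C.) The repair theorems R5 (p709208), `…SNCTwoHeights` (p718023), `…SNCManyHeights` (p718376),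
`…SNCFarRepairPairs` are stated on the CHART MODEL `𝔸⁵` (R1's frame). The walk's stage `W` carries the model only through an open immersion
`φ : V → W` (typ-3's zigzag charts: `V = 𝔸⁵`, `φ = Spec Θ ≫ chartImm`, readings `M.ideal.comap φ = hypSheaf p F`, `Zc.comap φ = 𝓘Λ`,
`D.comap φ` in the chart alphabet). This file is the GENERIC transport, for any locally Noetherian `W`, any open immersion `φ : V → W`, any
ideal sheaves `C` (the repair centre on `W`), `Z` (the centre to be made admissible) with `V(Z) ⊆ φ(V)`, any marked ideal `M` on `W` whose
boundary is snc with `C`, and ANY blowing up `τ : W′ → W` along `C`. PROVED here (no `sorry`, no new axiom):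

* `isBlowup_morphismRestrict_comp_isoOpensRange_inv` — `τ_V := (τ ∣_ φ(V)) ≫ (V ≅ φ(V))⁻¹ : τ⁻¹(φ(V)) → V` is a blowing up of `V` along
  `φ^*C` (Literature `IsBlowup.restrict` + `IsBlowup.comp_iso`);
* `strictTransformIdeal_model`, `controlledTransform_model`, `comap_centre_model`, `transformBoundary_model` — the transforms along `τ_V` of
  the pulled-back data `φ^*K`, `φ^*I`, `φ^*C`, `E.map φ^*` ARE the restrictions to `τ⁻¹(φ(V))` of the transforms along `τ` (Literature
  restriction kit `…_morphismRestrict`);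
* **`admissible_strictTransform_of_model`** — if for EVERY blowing up `τ_V` of `V` along `φ^*C` the strict transform of `φ^*Z` is regular,
  inside `supp((φ^*M).transform τ_V (φ^*C))`, and snc with the transformed boundary `(E.map φ^*).map St ++ [exc]` (this is what the chart-model
  repair theorems deliver), then `C' = St_τ(Z)` is REGULAR, `V(C') ⊆ supp(M.transform τ C)`, and `HasSNCWith (M.transform τ C).boundary C'`
  on `W′` (glue p692083 over the single open `τ⁻¹(φ(V)) ⊇ V(C')`).

USE (OPEN 4): with `C` the extension to the stage of the model's repair centre (Literature `BlowupSequencesExtendOpen`: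
`comap_vanishingIdeal_closureImage_support` for radical centres with closed image), the far repair theorems hold on typ-3's stage objects.
Nothing here is a statement about resolution of singularities in dimension ≥ 4 / characteristic `p` (NOT proved anywhere in this programme).
bears_on: LADDER-RESOLUTION:D157-DOOR2 (res-dim4-pi). Supports stmt-ResolutionOfSingularities-16155 (helper).
-/

-- every declaration of this summit lives under `Summit.ResolutionOfSingularities.ResolutionOfSingularities`
-- (summit = problem), which the duplicate-namespace linter flags; house convention (cf. the Target file).
set_option linter.dupNamespace false

noncomputable section

open CategoryTheory AlgebraicGeometry TopologicalSpace

namespace Summit.ResolutionOfSingularities.ResolutionOfSingularities.Theorems.PIDim4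

open Literature.AlgebraicGeometry.Resolution

namespace ChartDictionary

universe u

variable {W V W' : Scheme.{u}} (φ : V ⟶ W) [IsOpenImmersion φ] {C : W.IdealSheafData} {τ : W' ⟶ W}

/-! ## §1 The blowing up of the model induced over `φ(V)` -/

/-- `(V ≅ φ(V))⁻¹` followed by `φ` is the inclusion of `φ(V)`: pulled-back data agree. -/
theorem comap_comap_isoOpensRange_inv (K : W.IdealSheafData) : (K.comap φ).comap φ.isoOpensRange.inv = K.comap φ.opensRange.ι := by
  rw [← Scheme.IdealSheafData.comap_comp, Scheme.Hom.isoOpensRange_inv_comp]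

/-- **`τ_V := (τ ∣_ φ(V)) ≫ (V ≅ φ(V))⁻¹` is a blowing up of `V` along `φ^*C`** (Literature `IsBlowup.restrict` over the open `φ(V)`, then
`IsBlowup.comp_iso` along `V ≅ φ(V)`). -/
theorem isBlowup_morphismRestrict_comp_isoOpensRange_inv (hτ : IsBlowup τ C) :
    IsBlowup ((τ ∣_ φ.opensRange) ≫ φ.isoOpensRange.inv) (C.comap φ) := by
  have h := (hτ.restrict φ.opensRange).comp_iso φ.isoOpensRange.symm
  rw [Iso.symm_hom, Iso.symm_inv, ← Scheme.IdealSheafData.comap_comp, Scheme.Hom.isoOpensRange_hom_ι] at h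
  exact h

/-- **Strict transforms along `τ_V` of pulled-back data are restrictions**: `St_{τ_V}(φ^*K) = St_τ(K)|_{τ⁻¹φ(V)}`. -/
theorem strictTransformIdeal_model [IsLocallyNoetherian W'] (K : W.IdealSheafData) :
    strictTransformIdeal ((τ ∣_ φ.opensRange) ≫ φ.isoOpensRange.inv) (C.comap φ) (K.comap φ) =
      (strictTransformIdeal τ C K).comap (τ ⁻¹ᵁ φ.opensRange).ι := by
  rw [show strictTransformIdeal ((τ ∣_ φ.opensRange) ≫ φ.isoOpensRange.inv) (C.comap φ) (K.comap φ) =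
      strictTransformIdeal (τ ∣_ φ.opensRange) ((C.comap φ).comap φ.isoOpensRange.inv) ((K.comap φ).comap φ.isoOpensRange.inv) by
    simp only [strictTransformIdeal, Scheme.IdealSheafData.comap_comp],
    comap_comap_isoOpensRange_inv, comap_comap_isoOpensRange_inv, strictTransformIdeal_morphismRestrict]

/-- **Controlled transforms along `τ_V` of pulled-back data are restrictions**: `τ_Vᶜ(φ^*I, μ) = τᶜ(I, μ)|_{τ⁻¹φ(V)}`. -/
theorem controlledTransform_model [IsLocallyNoetherian W'] (I : W.IdealSheafData) (μ : ℕ) :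
    controlledTransform ((τ ∣_ φ.opensRange) ≫ φ.isoOpensRange.inv) (C.comap φ) (I.comap φ) μ =
      (controlledTransform τ C I μ).comap (τ ⁻¹ᵁ φ.opensRange).ι := by
  rw [show controlledTransform ((τ ∣_ φ.opensRange) ≫ φ.isoOpensRange.inv) (C.comap φ) (I.comap φ) μ =
      controlledTransform (τ ∣_ φ.opensRange) ((C.comap φ).comap φ.isoOpensRange.inv) ((I.comap φ).comap φ.isoOpensRange.inv) μ by
    simp only [controlledTransform, Scheme.IdealSheafData.comap_comp],
    comap_comap_isoOpensRange_inv, comap_comap_isoOpensRange_inv, controlledTransform_morphismRestrict]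

/-- **The exceptional ideal of `τ_V` is the restriction of the exceptional ideal of `τ`.** -/
theorem comap_centre_model : (C.comap φ).comap ((τ ∣_ φ.opensRange) ≫ φ.isoOpensRange.inv) =
    (C.comap τ).comap (τ ⁻¹ᵁ φ.opensRange).ι := by
  rw [Scheme.IdealSheafData.comap_comp, comap_comap_isoOpensRange_inv, comap_comap_morphismRestrict]

/-- **The transformed boundary of the model is the restricted transformed boundary**, member by member. -/
theorem transformBoundary_model [IsLocallyNoetherian W'] (E : List W.IdealSheafData) :
    (E.map (·.comap φ)).map (strictTransformIdeal ((τ ∣_ φ.opensRange) ≫ φ.isoOpensRange.inv) (C.comap φ)) ++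
        [(C.comap φ).comap ((τ ∣_ φ.opensRange) ≫ φ.isoOpensRange.inv)] =
      (E.map (strictTransformIdeal τ C) ++ [C.comap τ]).map (·.comap (τ ⁻¹ᵁ φ.opensRange).ι) := by
  rw [List.map_append, List.map_map, List.map_map, List.map_singleton, comap_centre_model]
  congr 1
  exact List.map_congr_left fun K _ => by simp only [Function.comp_apply, strictTransformIdeal_model]

/-! ## §2 Admissibility from the model -/

/-- **ADMISSIBILITY OF A STRICT TRANSFORM IS LOCAL OVER THE BASE.** `W` locally Noetherian, `φ : V → W` an open immersion, `C` (the centre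
blown up), `Z` (the centre to be made admissible, `V(Z) ⊆ φ(V)`) ideal sheaves on `W`, `M` a marked ideal on `W` whose boundary is snc with
`C`. If for EVERY blowing up `τ_V : V′ → V` along `φ^*C` the strict transform `St_{τ_V}(φ^*Z)` is regular, inside
`supp((φ^*M).transform τ_V (φ^*C))`, and snc with `(M.boundary.map φ^*).map St_{τ_V} ++ [τ_V^*φ^*C]` — the shape in which the chart-model
repair theorems (p709208, p718023, p718376) conclude — then for every blowing up `τ : W′ → W` along `C`: `C' = St_τ(Z)` is REGULAR,
`V(C') ⊆ supp(M.transform τ C)`, and `HasSNCWith (M.transform τ C).boundary C'` (BGMW Def. 3.1.3 (1)(2) on the stage). -/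
theorem admissible_strictTransform_of_model [IsLocallyNoetherian W] {Z : W.IdealSheafData} (M : MarkedIdeal W)
    (hZ : (Z.support : Set W) ⊆ Set.range φ) (hEC : HasSNCWith M.boundary C)
    (hV : ∀ ⦃V' : Scheme.{u}⦄ ⦃τV : V' ⟶ V⦄, IsBlowup τV (C.comap φ) →
      Scheme.IsRegular (strictTransformIdeal τV (C.comap φ) (Z.comap φ)).subscheme ∧
      ((strictTransformIdeal τV (C.comap φ) (Z.comap φ)).support : Set V') ⊆
        ((⟨M.ideal.comap φ, M.boundary.map (·.comap φ), M.mult⟩ : MarkedIdeal V).transform τV (C.comap φ)).support ∧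
      HasSNCWith ((M.boundary.map (·.comap φ)).map (strictTransformIdeal τV (C.comap φ)) ++ [(C.comap φ).comap τV])
        (strictTransformIdeal τV (C.comap φ) (Z.comap φ)))
    (hτ : IsBlowup τ C) :
    let M' := M.transform τ C
    let C' := strictTransformIdeal τ C Z
    Scheme.IsRegular C'.subscheme ∧ (C'.support : Set W') ⊆ M'.support ∧ HasSNCWith M'.boundary C' := by
  intro M' C'
  haveI : IsProper τ := hτ.isProper
  haveI : IsLocallyNoetherian W' := LocallyOfFiniteType.isLocallyNoetherian τ
  -- the induced blowing up of the model and its transforms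
  obtain ⟨hreg, hsupp, hsnc⟩ := hV (isBlowup_morphismRestrict_comp_isoOpensRange_inv φ hτ)
  rw [strictTransformIdeal_model] at hreg hsupp hsnc
  rw [transformBoundary_model] at hsnc
  -- the single open `τ⁻¹(φ(V))` covers `V(C')`
  have hcov : (C'.support : Set W') ⊆ ⋃ _ : Unit, Set.range (τ ⁻¹ᵁ φ.opensRange).ι := fun x hx => by
    refine Set.mem_iUnion.mpr ⟨(), ?_⟩
    rw [Scheme.Opens.range_ι]
    exact hZ (mem_support_of_mem_support_strictTransformIdeal hx)
  refine ⟨isRegular_subscheme_of_cover_comap (fun _ : Unit => (τ ⁻¹ᵁ φ.opensRange).ι) hcov fun _ => hreg,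
    support_subset_of_cover_comap (fun _ : Unit => (τ ⁻¹ᵁ φ.opensRange).ι) hcov fun _ => ?_, ?_⟩
  · intro x hx
    have h := hsupp hx
    change ((M.mult : ℕ) : ℕ∞) ≤ idealOrder (controlledTransform ((τ ∣_ φ.opensRange) ≫ φ.isoOpensRange.inv) (C.comap φ)
      (M.ideal.comap φ) M.mult) x at h
    rw [controlledTransform_model, idealOrder_comap_of_isOpenImmersion] at h
    exact h
  · rw [MarkedIdeal.transform_boundary]
    exact hasSNCWith_of_cover_comap (fun _ : Unit => (τ ⁻¹ᵁ φ.opensRange).ι) (hEC.hasSNC_transform hτ) hcov fun _ => hsnc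

end ChartDictionary

end Summit.ResolutionOfSingularities.ResolutionOfSingularities.Theorems.PIDim4

end
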